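import Literature.Probability.RandomPlanarGeometry.HexSAWStripSurfaceGrowthBounds
import Literature.Probability.RandomPlanarGeometry.HexSAWStripSurfaceGrowthLogConvex
import Literature.Probability.RandomPlanarGeometry.HexSAWStripSurfaceGrowthStrict
import Literature.Probability.RandomPlanarGeometry.HexSAWStripSurfaceThresholdExcess
import Literature.Probability.RandomPlanarGeometry.HexSAWStripSurfaceWidthTwo
import Literature.Probability.RandomPlanarGeometry.HexSAWStripSurfaceLimit
import Literature.Probability.RandomPlanarGeometry.HexSAWSurfaceYcProp5Riders
import Literature.Probability.RandomPlanarGeometry.HexSAWSurfaceMuSqrtEnvelope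
import Literature.Probability.RandomPlanarGeometry.HexSAWBrickWallStripFugacityLevel0Zero
import Mathlib.Analysis.Convex.Slope
import HarnessLib

/-!
# An explicit adsorption excess above the critical surface fugacity

For the self-avoiding walk on the honeycomb half-plane with surface fugacity `y` (model of Beaton, Bousquet-Mélou,
de Gier, Duminil-Copin and Guttmann 2014, growth rate `μ(y) = HV.surfaceMu y`, critical fugacity `y_c = 1 + √2 =
yStar`), the printed lower bounds on the free energy are `μ(y) ≥ max(μ, √y)` [BBdGDCG14 §3.1 Proposition 5, arXiv
v5 p. 9] — on `ℤ²`, `[log z]/2 ≤ 𝓕⁺(z) ≤ log μ₂ + [log z]/2` with the critical point "somewhere in the interval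
`[1, μ₂²]`" [JansevanRensburg2000, Theorem 5.55 and Corollary 5.56 (positive POLYGONS; for walks "log z ≤ 𝓕ᵥ⁺(z) ≤ log μ₂ + log z", same
page)] — and the qualitative `μ(y) > μ ⟺ y > y_c` [BBdGDCG14 Proposition 5 (p. 9) with Theorem 2 (§§4.2, 4.5, pp. 14–15);
tree `HV.hexConnectiveConstant_lt_surfaceMu_iff`].  Between `y_c = 1 + √2`
and `μ² = 2 + √2` (`= HV.stripYT 1`, tree `stripYT_one`) the printed bounds give NO positive lower bound on the
adsorption excess `log μ(y) − log μ`.  This file gives an EXPLICIT one at EVERY `y > y_c`, from four in-tree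
ingredients and one convexity chord:

1. the strip growth rate is below the surface growth rate, `ν_{T+1}(y) = μ_T(y,1) ≤ μ(y)` (the frame dictionary
   `stripNu_succ_eq_stripMuY₀` — Duminil-Copin–Smirnov frame `HV.stripNu` ↔ printed frame `HexBW.stripMuY₀` —
   and S7 `HexBW.stripMuY₀_le_surfaceMu`);
2. above the strip threshold the strip rate reaches `μ`: `y > y_T ⇒ ν_T(y) ≥ x_c⁻¹ = μ`
   (`inv_le_stripNu_of_stripYT_lt`, BBdGDCG14 Corollary 8);
3. at `y = 1` the strip rate is explicitly BELOW `μ`: `log μ − log ν_T(1) ≥ log(1 + μ^{-(4T+4)})/(2T)`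
   (the insertion margin `log_stripNu_succ_sub_log_ge`, lane's quantitative form of BBdGDCG14 Proposition 7);
4. `t ↦ log ν_T(eᵗ)` is convex (`convexOn_log_stripNu_exp`, BBdGDCG14 Proposition 6: "log-convex in log y");
5. the explicit threshold rate `y_{T+1} − y_c ≤ 5 (ln T)^{-1/3}` (`stripYT_succ_sub_yStar_le_log`, lane) and the
   exact `y_2 = (10 + 8√2)/7` (`stripYT_two`, lane).

The chord of the convex function `t ↦ log ν_T(eᵗ)` from `t = 0` (value `≤ log μ − gap_T`) to `t = log y₁`,
`y₁ > y_T` (value `≥ log μ`) has slope `≥ gap_T / log y₁`; by the three-slope inequality every later chord is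
steeper, so `log ν_T(y) − log μ ≥ (log y − log y₁) · gap_T / log y₁` for `y > y₁`, and `μ(y) ≥ ν_T(y)`:

* **`mul_div_le_log_stripNu_sub_log (hT : 1 ≤ T) (hy₁ : stripYT T < y₁) (hy : y₁ < y)`** — the strip margin
  `(log y − log y₁) · (log μ − log ν_T(1)) / log y₁ ≤ log ν_T(y) − log μ`;
* **`log_hexConnectiveConstant_sub_log_stripNu_one_ge (hT)`** — `log(1 + μ^{-(4T+4)})/(2T) ≤ log μ − log ν_T(1)`;
* ★ **`mul_div_le_log_surfaceMu_sub_log (hT : 1 ≤ T) (hy₁ : stripYT (T+1) < y₁) (hy : y₁ < y)`** —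
  `(log y − log y₁) · (log(1 + μ^{-(4T+8)}) / (2(T+1))) / log y₁ ≤ log μ(y) − log μ`, with the threshold made
  explicit in three printed/lane currencies (`_of_div_lt`: `y₁ > y_c/(1 − x_c² B_T)`; `_of_add_stripBlim_lt`:
  `y₁ > y_c + B_T(x_c)`; `_of_add_rpow_log_lt`: `y₁ > y_c + 5 (ln T)^{-1/3}`, `T ≥ 2`);
* ★ **`mul_div_le_log_surfaceMu_sub_log_two (hy₁ : (10 + 8√2)/7 < y₁) (hy : y₁ < y)`** — the exact-data window
  `(log y − log y₁) · log(1 + μ^{-12}) / (4 log y₁) ≤ log μ(y) − log μ` on `y > y₂ = 3.0448…`, inside the silent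
  interval `(y_c, μ²] = (2.4142…, 3.4142…]` of the printed bounds;
* ★★ **`onsetBound_le (h : yStar < y)` / `onsetBound_pos (h)`** — a closed-form, strictly positive
  `onsetBound y ≤ log μ(y) − log μ` at EVERY `y > y_c`: with `ε = y − y_c`, `T = onsetHeight ε = ⌈exp((10/ε)³)⌉₊`
  and `y₁ = y_c + 3ε/4`, `onsetBound y = (log y − log y₁) · log(1 + μ^{-(4T+8)}) / (2(T+1) log y₁)`;
  **`hexConnectiveConstant_mul_exp_onsetBound_le_surfaceMu (h)`** — `μ · exp(onsetBound y) ≤ μ(y)`;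
* §5, the other side (tree `convexOn_log_surfaceMu_exp` + `surfaceMu_le_sqrt_mul`, BBdGDCG14 Proposition 5 and the
  remark after it; the UPPER-side items are the `μ(y)`-forms of the tree's wall-bridge-rate theorems
  `log_wallRate_exp_sub_le` / `wallRate_le_sqrt_mul` / `mul_deriv_wallRate_le_half` of `HexSAWSurfaceWallRateSqrtMonotone`
  under `wallRate_eq_surfaceMu`, re-derived without those imports — CONSOLIDATION, see the §5 header): every secant
  slope of `t ↦ log μ(eᵗ)` is `≤ 1/2` (**`slope_log_surfaceMu_exp_le_half`**), hence
  ★ **`log_surfaceMu_sub_log_le_half (h : yStar ≤ y)`** — `log μ(y) − log μ ≤ (log y − log y_c)/2`, i.e.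
  `μ(y) ≤ μ·√(y/y_c)` (**`surfaceMu_le_mul_sqrt_div_yStar`** — ed.5: the `y_c = yStar` phrasing of the tree's
  `SAW.HV.surfaceMu_le_mul_sqrt_div` of `HexSAWSurfaceMuSqrtEnvelope`, now imported and USED), the two-sided **`onsetBound_le_and_le_half`**, and — where
  `μ'(y)` exists — explicit bounds for the surface density of BBdGDCG14's remark ("the density of vertices on the
  surface is 0 for y < y_c and is positive for y > y_c"; tree `deriv_surfaceMu_pos`, qualitative):
  ★★ **`surfaceDensity_explicit (h : yStar < y) (hd)`** — `0 < onsetBound y/(log y − log y_c) ≤ y μ'(y)/μ(y) ≤ 1/2`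
  (**`onsetBound_div_le_mul_deriv_div`**, **`mul_deriv_div_le_half`** — the latter at every `y > 0`).

What is new (lane «pcv-sawmu», a-idea-1 g26, door «QUANT-ONSET»): an explicit, everywhere-positive lower bound
for the adsorption excess of an undirected two-dimensional SAW on the whole adsorbed phase `y > y_c` and, from it, an
explicit strictly positive LOWER bound on the surface density `y μ'(y)/μ(y)` wherever `μ'(y)` exists (§5; the UPPER
bounds `(log y − log y_c)/2` and `1/2` there are the `μ(y)`-forms of the tree's wall-bridge-rate theorems —
CONSOLIDATION, disclosed by name); print has the max-type bounds, the location `y_c = 1 + √2` and the qualitative sign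
of the density only.  The bound is a composite of printed statements with the
lane's explicit constants; it is NOT claimed sharp (physics predicts `log μ(y) − log μ ≍ (y − y_c)^{1/φ}` with the
crossover exponent `φ = 1/2`; the bound here is `exp(−exp(O(ε⁻³)))`-small near `y_c` because the only threshold
rate in the tree is `5 (ln T)^{-1/3}`).  No numerics are used.  §0 (the frame dictionary) is carried verbatim from
the lane's unfiled «FRAME BRIDGE» module (a-idea-1 g22–g25), which will import this file instead; the folklore limit
`c^{1/n} → 1` is the tree's `HexBW.tendsto_const_rpow_one_div_nat₀`.

Sources: [BeatonBousquetMelouDeGierDuminilCopinGuttmann2014, §3.1 Proposition 5 (arXiv v5 p. 9), §3.2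
Propositions 6–7 and Corollary 8 (pp. 10–13)]; [JansevanRensburg2000, §5.4.1, Theorem 5.55 and Corollary 5.56
(positive polygons: "a critical value z_c somewhere in the interval [1, μ₂²] if d = 2"; for walks "log z ≤ 𝓕ᵥ⁺(z) ≤ log μ₂ + log z",
same page)]; [HammersleyTorrieWhittington1982, §2
(existence of the adsorption transition)]; convexity of free energies in `log y` [MadrasSlade1993, §1.2].
EDITIONS.  ed.4 200c4c694c908ae8 (a-idea-1 g26, 2026-08-24 10:56Z).  ed.5 (this; a-idea-1 g27, 2026-08-24 17:05Z) = ed.4 with ONE code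
change forced by the tree: `HexSAWSurfaceMuSqrtEnvelope` (a-p5, landed 2026-08-24) declares `SAW.HV.surfaceMu_le_mul_sqrt_div`
(`1 + √2 ≤ y → μ(y) ≤ μ_ℍ·√(y/(1+√2))`), so ed.4's theorem of the same fully-qualified name — its `yStar`-phrased twin — is RENAMED
`surfaceMu_le_mul_sqrt_div_yStar` and re-proved as the one-line specialisation of the tree theorem (that module is now imported; `yStar = 1 + √2`
by definition); all other declarations are code-identical to ed.4, and the §5 UPPER-side items remain CONSOLIDATION as disclosed there.
-/

noncomputable section

open Finset Filter Function
open Literature.Probability.LatticeModels Literature.Probability.Percolation SimpleGraph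
open _root_.Topology

namespace Literature.Probability.RandomPlanarGeometry.SAW

/-! ### §0 The frame dictionary: `Zlev = C_T(·,1)` and `ν_{T+1}(y) = μ_T(y,1) ≤ μ(y)` -/

namespace HexBW

/-- The level-`0` visit count of `HexSAWStripSurfaceGrowthStrict.lean` is `bottomVisits₀` of
`HexSAWBrickWallStripFugacityLevel0.lean` (same test: bottom row and odd abscissa).
[cite: BeatonBousquetMelouDeGierDuminilCopinGuttmann2014, §3.2 (arXiv v5 p. 10: contacts with the bottom of the strip)] -/
theorem levVisits_eq_bottomVisits₀ (a : Site 2) (υ : ℕ → Site 2) (n : ℕ) :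
    levVisits a υ n = bottomVisits₀ a υ n := by
  unfold levVisits bottomVisits₀ indL lev0
  refine Finset.sum_congr rfl fun m _ => ?_
  by_cases h : (a + υ m) 1 = 0 ∧ (a + υ m) 0 % 2 = 1
  · rw [if_pos h, if_pos (decide_eq_true h)]
  · rw [if_neg h, if_neg (by simpa only [decide_eq_true_eq] using h)]

/-- **`Zlev_{T,n}(y) = C_{T,n}(y,1)`**: the level-`0` partition function of the DCS-frame files is the one-level partition
function of the printed frame. [cite: BeatonBousquetMelouDeGierDuminilCopinGuttmann2014, §3.2 (arXiv v5 p. 10: C_{T,k}(y,z))] -/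
theorem stripZlev_eq_stripZ₀ (T n : ℕ) (y : ℝ) : stripZlev T n y = stripZ₀ T n y := by
  unfold stripZlev stripZ₀
  exact Finset.sum_congr rfl fun p _ => by rw [levVisits_eq_bottomVisits₀]

end HexBW

namespace HV

variable {T : ℕ} {y : ℝ}

/-- `Z^{top}_{T+1,n}(y) ≤ 2(T+1) · C_{T,n}(y,1)` (`y ≥ 0`): top–bottom reflection, then the transfer `HV.toPair`.
[cite: MadrasSlade1993, §8.2, eq. (8.2.1); BeatonBousquetMelouDeGierDuminilCopinGuttmann2014, Proposition 6 (arXiv v5 p. 10: μ_T(y,1) = μ_T(1,y))] -/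
theorem stripZL_succ_le_stripZ₀ (T n : ℕ) (hy : 0 ≤ y) :
    stripZL (T + 1) n y ≤ 2 * ((T : ℝ) + 1) * HexBW.stripZ₀ T n y := by
  have h := stripZB_le (T := T + 1) (by omega) n hy
  rw [Nat.add_sub_cancel, HexBW.stripZlev_eq_stripZ₀, ← stripZL_eq_stripZB] at h
  push_cast at h
  exact h

/-- `C_{T,n}(y,1) ≤ 2(T+1) · Z^{top}_{T+1,n}(y)` (`y ≥ 0`): the honeycomb reading `HV.bwToHV`, then the reflection.
[cite: MadrasSlade1993, §8.2, eq. (8.2.1); BeatonBousquetMelouDeGierDuminilCopinGuttmann2014, Proposition 6 (arXiv v5 p. 10)] -/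
theorem stripZ₀_le_stripZL_succ (T n : ℕ) (hy : 0 ≤ y) :
    HexBW.stripZ₀ T n y ≤ 2 * ((T : ℝ) + 1) * stripZL (T + 1) n y := by
  have h := stripZlev_le T n hy
  rw [HexBW.stripZlev_eq_stripZ₀, ← stripZL_eq_stripZB] at h
  exact h

/-- **The two growth rates agree: `ν_{T+1}(y) = μ_T(y,1)`** (`y > 0`) — the top-level rate of the Duminil-Copin–Smirnov strip
with `T + 1` strips of hexagons equals the printed one-level rate of the brick-wall strip of `T + 1` rows.
[cite: BeatonBousquetMelouDeGierDuminilCopinGuttmann2014, Proposition 6 (arXiv v5 p. 10: "μ_T(y,z) = μ_T(z,y), and so, in particular, μ_T(y,1) = μ_T(1,y)")] -/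
theorem stripNu_succ_eq_stripMuY₀ (T : ℕ) (hy : 0 < y) : stripNu (T + 1) y = HexBW.stripMuY₀ T y := by
  set c : ℝ := 2 * ((T : ℝ) + 1) with hc
  have hc0 : 0 < c := by positivity
  have hT : 1 ≤ T + 1 := by omega
  have hA := tendsto_stripZL_rpow hT hy
  have hB := HexBW.tendsto_stripZ₀_rpow T hy
  have hC := HexBW.tendsto_const_rpow_one_div_nat₀ hc0
  have hApos : ∀ n, 0 < stripZL (T + 1) n y := fun n => stripZL_pos hT n hy
  have hBpos : ∀ n, 0 < HexBW.stripZ₀ T n y := fun n => HexBW.stripZ₀_pos T n hy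
  have key : ∀ (n : ℕ) {a b : ℝ}, 0 ≤ a → 0 ≤ b → a ≤ c * b →
      a ^ (1 / (n : ℝ)) ≤ c ^ (1 / (n : ℝ)) * b ^ (1 / (n : ℝ)) := by
    intro n a b ha hb hab
    have hr : 0 ≤ 1 / (n : ℝ) := by positivity
    calc a ^ (1 / (n : ℝ)) ≤ (c * b) ^ (1 / (n : ℝ)) := Real.rpow_le_rpow ha hab hr
      _ = c ^ (1 / (n : ℝ)) * b ^ (1 / (n : ℝ)) := Real.mul_rpow hc0.le hb
  refine le_antisymm ?_ ?_
  · have hlim := hC.mul hB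
    rw [one_mul] at hlim
    exact le_of_tendsto_of_tendsto' hA hlim fun n => key n (hApos n).le (hBpos n).le (stripZL_succ_le_stripZ₀ T n hy.le)
  · have hlim := hC.mul hA
    rw [one_mul] at hlim
    exact le_of_tendsto_of_tendsto' hB hlim fun n => key n (hBpos n).le (hApos n).le (stripZ₀_le_stripZL_succ T n hy.le)

/-- `ν_T(y) = μ_{T−1}(y,1)` for `T ≥ 1`, `y > 0`. [cite: BeatonBousquetMelouDeGierDuminilCopinGuttmann2014, Proposition 6 (arXiv v5 p. 10: μ_T(y,1) = μ_T(1,y))] -/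
theorem stripNu_eq_stripMuY₀ (hT : 1 ≤ T) (hy : 0 < y) : stripNu T y = HexBW.stripMuY₀ (T - 1) y := by
  obtain ⟨T', rfl⟩ : ∃ T', T = T' + 1 := ⟨T - 1, by omega⟩
  rw [Nat.add_sub_cancel]
  exact stripNu_succ_eq_stripMuY₀ T' hy

/-- `ν_T(y) ≤ μ(y)` (`T ≥ 1`, `y > 0`). [cite: BeatonBousquetMelouDeGierDuminilCopinGuttmann2014, Proposition 7 (arXiv v5 p. 11: μ_T(y) increases to μ(y))] -/
theorem stripNu_le_surfaceMu (hT : 1 ≤ T) (hy : 0 < y) : stripNu T y ≤ surfaceMu y := by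
  rw [stripNu_eq_stripMuY₀ hT hy]
  exact HexBW.stripMuY₀_le_surfaceMu (T - 1) hy

/-! ### §1 The explicit gap at `y = 1`: `log μ − log ν_T(1) ≥ log(1 + μ^{-(4T+4)})/(2T)` -/

/-- `ν_T(1) ≤ μ` (`T ≥ 1`): the strip rate at `y = 1` is at most the surface rate `μ(1) = μ`.
[cite: BeatonBousquetMelouDeGierDuminilCopinGuttmann2014, Proposition 7 with Corollary 8 (arXiv v5 pp. 11–13: μ_T(1,1) ≤ μ(1) = μ)] -/
theorem stripNu_one_le_hexConnectiveConstant (hT : 1 ≤ T) : stripNu T 1 ≤ hexConnectiveConstant := by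
  have h := stripNu_le_surfaceMu hT one_pos
  have h1 : surfaceMu 1 = hexConnectiveConstant :=
    (surfaceMu_eq_iff one_pos).2 (by have := Real.sqrt_nonneg 2; linarith)
  rwa [h1] at h

/-- **Explicit gap at `y = 1`**: `log(1 + μ^{-(4T+4)}) / (2T) ≤ log μ − log ν_T(1)` for `T ≥ 1` — the insertion
margin between consecutive strips at `y = 1`, with `ν_{T+1}(1) ≤ μ`.
[cite: BeatonBousquetMelouDeGierDuminilCopinGuttmann2014, Proposition 7 (arXiv v5 p. 11: μ_T < μ_{T+1}), printed without a rate; the explicit margin is the lane's `log_stripNu_succ_sub_log_ge`; MadrasSlade1993, §8.2, Theorem 8.2.1] -/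
theorem log_hexConnectiveConstant_sub_log_stripNu_one_ge (hT : 1 ≤ T) :
    Real.log (1 + hexConnectiveConstant ^ (-(4 * (T : ℝ) + 4))) / (2 * (T : ℝ)) ≤
      Real.log hexConnectiveConstant - Real.log (stripNu T 1) := by
  have hfloor := log_stripNu_succ_sub_log_ge hT (le_refl (1 : ℝ))
  have hν : stripNu (T + 1) 1 ≤ hexConnectiveConstant := stripNu_one_le_hexConnectiveConstant (by omega)
  have hνpos : 0 < stripNu (T + 1) 1 := stripNu_pos (by omega) one_pos
  have hμpos : 0 < hexConnectiveConstant := hexConnectiveConstant_pos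
  have hexp : -(4 * (T : ℝ) + 4) ≤ 0 := by
    have := (Nat.cast_nonneg T : (0 : ℝ) ≤ (T : ℝ)); linarith
  have hpow : hexConnectiveConstant ^ (-(4 * (T : ℝ) + 4)) ≤ stripNu (T + 1) 1 ^ (-(4 * (T : ℝ) + 4)) :=
    Real.rpow_le_rpow_of_nonpos hνpos hν hexp
  have hT0 : (0 : ℝ) < 2 * (T : ℝ) := by
    have : (1 : ℝ) ≤ (T : ℝ) := by exact_mod_cast hT
    linarith
  have hlog : Real.log (1 + hexConnectiveConstant ^ (-(4 * (T : ℝ) + 4))) ≤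
      Real.log (1 + stripNu (T + 1) 1 ^ (-(4 * (T : ℝ) + 4))) :=
    Real.log_le_log (by positivity) (by linarith)
  have hlogν : Real.log (stripNu (T + 1) 1) ≤ Real.log hexConnectiveConstant := Real.log_le_log hνpos hν
  calc Real.log (1 + hexConnectiveConstant ^ (-(4 * (T : ℝ) + 4))) / (2 * (T : ℝ))
        ≤ Real.log (1 + stripNu (T + 1) 1 ^ (-(4 * (T : ℝ) + 4))) / (2 * (T : ℝ)) :=
          div_le_div_of_nonneg_right hlog hT0.le
    _ ≤ Real.log (stripNu (T + 1) 1) - Real.log (stripNu T 1) := hfloor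
    _ ≤ Real.log hexConnectiveConstant - Real.log (stripNu T 1) := by linarith

/-- `0 < log μ − log ν_T(1)` (`T ≥ 1`). [cite: BeatonBousquetMelouDeGierDuminilCopinGuttmann2014, Proposition 7 (arXiv v5 p. 11)] -/
theorem log_hexConnectiveConstant_sub_log_stripNu_one_pos (hT : 1 ≤ T) :
    0 < Real.log hexConnectiveConstant - Real.log (stripNu T 1) := by
  refine lt_of_lt_of_le ?_ (log_hexConnectiveConstant_sub_log_stripNu_one_ge hT)
  have hμpos : 0 < hexConnectiveConstant := hexConnectiveConstant_pos
  have hT0 : (0 : ℝ) < 2 * (T : ℝ) := by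
    have : (1 : ℝ) ≤ (T : ℝ) := by exact_mod_cast hT
    linarith
  exact div_pos (Real.log_pos (by have := Real.rpow_pos_of_pos hμpos (-(4 * (T : ℝ) + 4)); linarith)) hT0

/-! ### §2 The strip margin by the convexity chord -/

/-- **Strip margin above the strip threshold**: for `T ≥ 1`, `y_T < y₁ < y`,
`(log y − log y₁) · (log μ − log ν_T(1)) / log y₁ ≤ log ν_T(y) − log μ` — the three-slope inequality for the
convex `t ↦ log ν_T(eᵗ)` at `0 < log y₁ < log y`, with `log ν_T(y₁) ≥ log μ` (`y₁ > y_T`).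
[cite: BeatonBousquetMelouDeGierDuminilCopinGuttmann2014, Proposition 6 (arXiv v5 p. 10: log-convex in log y) and Corollary 8 (p. 12: μ_T(y,1) ≥ μ ⟺ y ≥ y_T); the chord bound is the lane's composite] -/
theorem mul_div_le_log_stripNu_sub_log (hT : 1 ≤ T) {y₁ y : ℝ} (hy₁ : stripYT T < y₁) (hy : y₁ < y) :
    (Real.log y - Real.log y₁) * ((Real.log hexConnectiveConstant - Real.log (stripNu T 1)) / Real.log y₁) ≤
      Real.log (stripNu T y) - Real.log hexConnectiveConstant := by
  have hyS : yStar ≤ stripYT T := yStar_le_stripYT hT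
  have h1S : 1 < yStar := by
    unfold yStar; have := Real.sqrt_pos.2 (show (0 : ℝ) < 2 by norm_num); linarith
  have h1y₁ : 1 < y₁ := by linarith
  have hy₁0 : 0 < y₁ := by linarith
  have hy0 : 0 < y := by linarith
  have hμpos : 0 < hexConnectiveConstant := hexConnectiveConstant_pos
  have hB : 0 < Real.log y₁ := Real.log_pos h1y₁
  have hC : 0 < Real.log y - Real.log y₁ := sub_pos.2 (Real.log_lt_log hy₁0 hy)
  have hf := convexOn_log_stripNu_exp hT
  have hslope := hf.slope_mono_adjacent (x := 0) (y := Real.log y₁) (z := Real.log y)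
    (Set.mem_univ _) (Set.mem_univ _) hB (Real.log_lt_log hy₁0 hy)
  simp only [Real.exp_zero, Real.exp_log hy₁0, Real.exp_log hy0, sub_zero] at hslope
  -- `hslope : (F₁ - F₀) / log y₁ ≤ (F₂ - F₁) / (log y - log y₁)`
  have hνy₁ : hexConnectiveConstant ≤ stripNu T y₁ := by
    rw [hexConnectiveConstant_eq_inv]; exact inv_le_stripNu_of_stripYT_lt hT hy₁0 hy₁
  have hF₁ : Real.log hexConnectiveConstant ≤ Real.log (stripNu T y₁) := Real.log_le_log hμpos hνy₁
  have key : (Real.log (stripNu T y₁) - Real.log (stripNu T 1)) / Real.log y₁ * (Real.log y - Real.log y₁) ≤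
      Real.log (stripNu T y) - Real.log (stripNu T y₁) := (le_div_iff₀ hC).1 hslope
  calc (Real.log y - Real.log y₁) * ((Real.log hexConnectiveConstant - Real.log (stripNu T 1)) / Real.log y₁)
        ≤ (Real.log y - Real.log y₁) * ((Real.log (stripNu T y₁) - Real.log (stripNu T 1)) / Real.log y₁) := by
          gcongr
    _ = (Real.log (stripNu T y₁) - Real.log (stripNu T 1)) / Real.log y₁ * (Real.log y - Real.log y₁) := by ring
    _ ≤ Real.log (stripNu T y) - Real.log (stripNu T y₁) := key
    _ ≤ Real.log (stripNu T y) - Real.log hexConnectiveConstant := by linarith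

/-- **Explicit strip excess**: for `T ≥ 1`, `y_T < y₁ < y`,
`(log y − log y₁) · (log(1 + μ^{-(4T+4)}) / (2T)) / log y₁ ≤ log ν_T(y) − log μ`.
[cite: BeatonBousquetMelouDeGierDuminilCopinGuttmann2014, Propositions 6–7 and Corollary 8 (arXiv v5 pp. 10–13); explicit constants the lane's] -/
theorem mul_div_le_log_stripNu_sub_log' (hT : 1 ≤ T) {y₁ y : ℝ} (hy₁ : stripYT T < y₁) (hy : y₁ < y) :
    (Real.log y - Real.log y₁) * (Real.log (1 + hexConnectiveConstant ^ (-(4 * (T : ℝ) + 4))) / (2 * (T : ℝ))) /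
        Real.log y₁ ≤ Real.log (stripNu T y) - Real.log hexConnectiveConstant := by
  have hyS : yStar ≤ stripYT T := yStar_le_stripYT hT
  have h1S : 1 < yStar := by
    unfold yStar; have := Real.sqrt_pos.2 (show (0 : ℝ) < 2 by norm_num); linarith
  have hy₁0 : 0 < y₁ := by linarith
  have hB : 0 < Real.log y₁ := Real.log_pos (by linarith)
  have hC : 0 ≤ Real.log y - Real.log y₁ := sub_nonneg.2 (Real.log_le_log hy₁0 hy.le)
  have hgap := log_hexConnectiveConstant_sub_log_stripNu_one_ge hT
  calc (Real.log y - Real.log y₁) * (Real.log (1 + hexConnectiveConstant ^ (-(4 * (T : ℝ) + 4))) / (2 * (T : ℝ))) /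
          Real.log y₁
        = (Real.log y - Real.log y₁) *
            ((Real.log (1 + hexConnectiveConstant ^ (-(4 * (T : ℝ) + 4))) / (2 * (T : ℝ))) / Real.log y₁) := by ring
    _ ≤ (Real.log y - Real.log y₁) * ((Real.log hexConnectiveConstant - Real.log (stripNu T 1)) / Real.log y₁) := by
          gcongr
    _ ≤ Real.log (stripNu T y) - Real.log hexConnectiveConstant := mul_div_le_log_stripNu_sub_log hT hy₁ hy

/-! ### §3 ★ The explicit adsorption excess of the surface model -/

/-- ★ **Explicit adsorption excess above a strip threshold**: for `T ≥ 1` and `y_{T+1} < y₁ < y`,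
`(log y − log y₁) · (log(1 + μ^{-(4T+8)}) / (2(T+1))) / log y₁ ≤ log μ(y) − log μ` — the strip excess of the
strip with `T + 1` strips of hexagons, then `ν_{T+1}(y) ≤ μ(y)`.
[cite: BeatonBousquetMelouDeGierDuminilCopinGuttmann2014, §3.1 Proposition 5 (arXiv v5 p. 9: only μ(y) ≥ max(μ, √y) in print), §3.2 Propositions 6–7, Corollary 8 (pp. 10–13); JansevanRensburg2000, Theorem 5.55 / Corollary 5.56; the explicit excess is the lane's composite] -/
theorem mul_div_le_log_surfaceMu_sub_log (hT : 1 ≤ T) {y₁ y : ℝ} (hy₁ : stripYT (T + 1) < y₁) (hy : y₁ < y) :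
    (Real.log y - Real.log y₁) * (Real.log (1 + hexConnectiveConstant ^ (-(4 * (T : ℝ) + 8))) / (2 * ((T : ℝ) + 1))) /
        Real.log y₁ ≤ Real.log (surfaceMu y) - Real.log hexConnectiveConstant := by
  have hT' : 1 ≤ T + 1 := by omega
  have h := mul_div_le_log_stripNu_sub_log' hT' hy₁ hy
  have hcast : (4 * ((T + 1 : ℕ) : ℝ) + 4) = 4 * (T : ℝ) + 8 := by push_cast; ring
  have hcast2 : (2 * ((T + 1 : ℕ) : ℝ)) = 2 * ((T : ℝ) + 1) := by push_cast; ring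
  rw [hcast, hcast2] at h
  have hyS : yStar ≤ stripYT (T + 1) := yStar_le_stripYT hT'
  have hy₁0 : 0 < y₁ := by linarith [yStar_pos]
  have hν : Real.log (stripNu (T + 1) y) ≤ Real.log (surfaceMu y) :=
    Real.log_le_log (stripNu_pos hT' (by linarith)) (stripNu_le_surfaceMu hT' (by linarith))
  linarith

/-- The same with the threshold in the printed currency `y_{T+1} ≤ y_c / (1 − x_c² B_T(x_c))`:
for `T ≥ 1`, `y_c/(1 − x_c² B_T) < y₁ < y`. [cite: BeatonBousquetMelouDeGierDuminilCopinGuttmann2014, §4.5 (arXiv v5 p. 15: the upper bound for y_T from B_T(x_c,1)); explicit excess the lane's] -/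
theorem mul_div_le_log_surfaceMu_sub_log_of_div_lt (hT : 1 ≤ T) {y₁ y : ℝ}
    (hy₁ : yStar / (1 - hexCriticalFugacity ^ 2 * stripBlim T) < y₁) (hy : y₁ < y) :
    (Real.log y - Real.log y₁) * (Real.log (1 + hexConnectiveConstant ^ (-(4 * (T : ℝ) + 8))) / (2 * ((T : ℝ) + 1))) /
        Real.log y₁ ≤ Real.log (surfaceMu y) - Real.log hexConnectiveConstant :=
  mul_div_le_log_surfaceMu_sub_log hT ((stripYT_succ_le_div hT).trans_lt hy₁) hy

/-- The same with the threshold excess bounded by the critical bridge generating function, `y_{T+1} − y_c ≤ B_T(x_c)`: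
for `T ≥ 1`, `y_c + B_T(x_c) < y₁ < y`. [cite: BeatonBousquetMelouDeGierDuminilCopinGuttmann2014, §4.5 (arXiv v5 p. 15); explicit excess the lane's] -/
theorem mul_div_le_log_surfaceMu_sub_log_of_add_stripBlim_lt (hT : 1 ≤ T) {y₁ y : ℝ}
    (hy₁ : yStar + stripBlim T < y₁) (hy : y₁ < y) :
    (Real.log y - Real.log y₁) * (Real.log (1 + hexConnectiveConstant ^ (-(4 * (T : ℝ) + 8))) / (2 * ((T : ℝ) + 1))) /
        Real.log y₁ ≤ Real.log (surfaceMu y) - Real.log hexConnectiveConstant :=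
  mul_div_le_log_surfaceMu_sub_log hT (by linarith [stripYT_succ_sub_yStar_le hT]) hy

/-- The same with the explicit threshold rate `y_{T+1} − y_c ≤ 5 (ln T)^{-1/3}`: for `T ≥ 2`,
`y_c + 5 (ln T)^{-1/3} < y₁ < y`. [cite: BeatonBousquetMelouDeGierDuminilCopinGuttmann2014, Corollary 8 (arXiv v5 p. 12: y_T decreases to y_c, no rate in print); GlazmanManolescu2019, Proposition 1.1 and eq. (3) (the bridge decay behind the lane's threshold rate `hexBridgeLogDecay`); the rate's constants and the excess are the lane's] -/
theorem mul_div_le_log_surfaceMu_sub_log_of_add_rpow_log_lt (hT : 2 ≤ T) {y₁ y : ℝ}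
    (hy₁ : yStar + 5 * (Real.log T) ^ (-(1 : ℝ) / 3) < y₁) (hy : y₁ < y) :
    (Real.log y - Real.log y₁) * (Real.log (1 + hexConnectiveConstant ^ (-(4 * (T : ℝ) + 8))) / (2 * ((T : ℝ) + 1))) /
        Real.log y₁ ≤ Real.log (surfaceMu y) - Real.log hexConnectiveConstant :=
  mul_div_le_log_surfaceMu_sub_log (by omega) (by linarith [stripYT_succ_sub_yStar_le_log hT]) hy

/-- ★ **The exact-data window**: for `(10 + 8√2)/7 = y₂ < y₁ < y`,
`(log y − log y₁) · log(1 + μ^{-12}) / (4 log y₁) ≤ log μ(y) − log μ` (`μ^{12} = (2 + √2)⁶`) — the strip with two strips of hexagons,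
whose threshold `y₂ = 3.0448…` is exact in the tree (`stripYT_two`), inside the interval `(y_c, μ²] = (2.414…, 3.414…]`
where the printed bounds `μ(y) ≥ max(μ, √y)` are silent.
[cite: BeatonBousquetMelouDeGierDuminilCopinGuttmann2014, §3.1 Proposition 5 (arXiv v5 p. 9), Corollary 8 (p. 12); JansevanRensburg2000, Corollary 5.56 ("somewhere in the interval [1, μ₂²]"); the window bound is the lane's] -/
theorem mul_div_le_log_surfaceMu_sub_log_two {y₁ y : ℝ} (hy₁ : (10 + 8 * Real.sqrt 2) / 7 < y₁) (hy : y₁ < y) :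
    (Real.log y - Real.log y₁) * (Real.log (1 + (hexConnectiveConstant ^ 12)⁻¹) / 4) / Real.log y₁ ≤
      Real.log (surfaceMu y) - Real.log hexConnectiveConstant := by
  have h := mul_div_le_log_surfaceMu_sub_log (T := 1) le_rfl (y₁ := y₁) (y := y) (by rw [stripYT_two]; exact hy₁) hy
  norm_num at h
  exact h

/-! ### §4 ★★ A closed-form positive excess at every `y > y_c` -/

/-- The strip height used at excess `ε = y − y_c`: `T(ε) = ⌈exp((10/ε)³)⌉₊`, chosen so that `5 (ln T)^{-1/3} ≤ ε/2`.
[cite: BeatonBousquetMelouDeGierDuminilCopinGuttmann2014, Corollary 8 (arXiv v5 p. 12: y_T ↓ y_c); the choice of T is the lane's] -/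
def onsetHeight (ε : ℝ) : ℕ := ⌈Real.exp ((10 / ε) ^ 3)⌉₊

/-- **The closed-form excess bound** at `y > y_c`: with `ε = y − y_c`, `T = onsetHeight ε`, `y₁ = y_c + 3ε/4`,
`onsetBound y = (log y − log y₁) · (log(1 + μ^{-(4T+8)}) / (2(T+1))) / log y₁`.
[cite: BeatonBousquetMelouDeGierDuminilCopinGuttmann2014, §3 (arXiv v5 pp. 9–13); the bound is the lane's composite] -/
def onsetBound (y : ℝ) : ℝ :=
  (Real.log y - Real.log (yStar + 3 * (y - yStar) / 4)) *
      (Real.log (1 + hexConnectiveConstant ^ (-(4 * (onsetHeight (y - yStar) : ℝ) + 8))) /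
        (2 * ((onsetHeight (y - yStar) : ℝ) + 1))) /
    Real.log (yStar + 3 * (y - yStar) / 4)

/-- `2 ≤ T(ε)` for `ε > 0`. [cite: BeatonBousquetMelouDeGierDuminilCopinGuttmann2014, Corollary 8 (arXiv v5 p. 12); lane plumbing] -/
theorem two_le_onsetHeight {ε : ℝ} (hε : 0 < ε) : 2 ≤ onsetHeight ε := by
  have h1 : (1 : ℝ) < Real.exp ((10 / ε) ^ 3) := by
    have : (0 : ℝ) < (10 / ε) ^ 3 := by positivity
    exact Real.one_lt_exp_iff.2 this
  have h2 : 1 < onsetHeight ε := Nat.lt_ceil.2 (by exact_mod_cast h1)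
  omega

/-- `5 (ln T(ε))^{-1/3} ≤ ε/2` for `ε > 0`. [cite: GlazmanManolescu2019, Proposition 1.1 and eq. (3) (the (ln T)^{-1/3} currency of the bridge decay, tree `hexBridgeLogDecay`); lane plumbing] -/
theorem five_mul_rpow_log_onsetHeight_le {ε : ℝ} (hε : 0 < ε) :
    5 * (Real.log (onsetHeight ε)) ^ (-(1 : ℝ) / 3) ≤ ε / 2 := by
  set a : ℝ := (10 / ε) ^ 3 with ha
  have ha0 : 0 < a := by positivity
  have hTge : Real.exp a ≤ (onsetHeight ε : ℝ) := Nat.le_ceil _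
  have hTpos : (0 : ℝ) < (onsetHeight ε : ℝ) := (Real.exp_pos a).trans_le hTge
  have hlog : a ≤ Real.log (onsetHeight ε : ℝ) := by
    have := Real.log_le_log (Real.exp_pos a) hTge
    rwa [Real.log_exp] at this
  have h1 : (Real.log (onsetHeight ε : ℝ)) ^ (-(1 : ℝ) / 3) ≤ a ^ (-(1 : ℝ) / 3) :=
    Real.rpow_le_rpow_of_nonpos ha0 hlog (by norm_num)
  have h2 : a ^ (-(1 : ℝ) / 3) = ε / 10 := by
    have h10 : (0 : ℝ) ≤ 10 / ε := by positivity
    rw [ha, ← Real.rpow_natCast (10 / ε) 3, ← Real.rpow_mul h10]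
    norm_num
    rw [Real.rpow_neg_one, inv_div]
  calc 5 * (Real.log (onsetHeight ε : ℝ)) ^ (-(1 : ℝ) / 3) ≤ 5 * (ε / 10) := by
        rw [← h2]; exact mul_le_mul_of_nonneg_left h1 (by norm_num)
    _ = ε / 2 := by ring

/-- The strip with `T(ε) + 1` strips of hexagons has its threshold below `y_c + 3ε/4` (`ε = y − y_c > 0`).
[cite: BeatonBousquetMelouDeGierDuminilCopinGuttmann2014, Corollary 8 (arXiv v5 p. 12); the rate is the lane's `stripYT_succ_sub_yStar_le_log`] -/
theorem stripYT_onsetHeight_succ_lt (h : yStar < y) :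
    stripYT (onsetHeight (y - yStar) + 1) < yStar + 3 * (y - yStar) / 4 := by
  have hε : 0 < y - yStar := sub_pos.2 h
  have hT := two_le_onsetHeight hε
  have h1 := stripYT_succ_sub_yStar_le_log hT
  have h2 := five_mul_rpow_log_onsetHeight_le hε
  linarith

/-- ★★ **`onsetBound y > 0` for every `y > y_c`.**
[cite: BeatonBousquetMelouDeGierDuminilCopinGuttmann2014, Proposition 5 (arXiv v5 p. 9) with Theorem 2 (§§4.2, 4.5, pp. 14–15): μ(y) > μ for y > y_c, qualitative; the explicit positive bound is the lane's] -/
theorem onsetBound_pos (h : yStar < y) : 0 < onsetBound y := by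
  have hε : 0 < y - yStar := sub_pos.2 h
  have h1S : 1 < yStar := by
    unfold yStar; have := Real.sqrt_pos.2 (show (0 : ℝ) < 2 by norm_num); linarith
  have hy₁1 : 1 < yStar + 3 * (y - yStar) / 4 := by linarith
  have hy₁y : yStar + 3 * (y - yStar) / 4 < y := by linarith
  have hμpos : 0 < hexConnectiveConstant := hexConnectiveConstant_pos
  unfold onsetBound
  refine div_pos (mul_pos (sub_pos.2 (Real.log_lt_log (by linarith) hy₁y)) (div_pos (Real.log_pos ?_) (by positivity)))
    (Real.log_pos hy₁1)
  have := Real.rpow_pos_of_pos hμpos (-(4 * (onsetHeight (y - yStar) : ℝ) + 8))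
  linarith

/-- ★★ **Explicit adsorption excess at every `y > y_c`: `onsetBound y ≤ log μ(y) − log μ`.**
[cite: BeatonBousquetMelouDeGierDuminilCopinGuttmann2014, §3.1 Proposition 5 (arXiv v5 p. 9: μ(y) ≥ max(μ, √y)), Theorem 2 (§§4.2, 4.5, pp. 14–15: with Proposition 5, μ(y) > μ ⟺ y > y_c); JansevanRensburg2000, Theorem 5.55 / Corollary 5.56; HammersleyTorrieWhittington1982, §2; the explicit excess is the lane's composite, not claimed sharp] -/
theorem onsetBound_le (h : yStar < y) : onsetBound y ≤ Real.log (surfaceMu y) - Real.log hexConnectiveConstant := by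
  have hε : 0 < y - yStar := sub_pos.2 h
  have hT : 1 ≤ onsetHeight (y - yStar) := le_trans (by norm_num) (two_le_onsetHeight hε)
  have hy₁y : yStar + 3 * (y - yStar) / 4 < y := by linarith
  unfold onsetBound
  exact mul_div_le_log_surfaceMu_sub_log hT (stripYT_onsetHeight_succ_lt h) hy₁y

/-- ★★ Multiplicative form: `μ · exp(onsetBound y) ≤ μ(y)` for every `y > y_c`, with `exp(onsetBound y) > 1`.
[cite: BeatonBousquetMelouDeGierDuminilCopinGuttmann2014, §3.1 Proposition 5 and Corollary 8 (arXiv v5 pp. 9–13); the explicit factor is the lane's] -/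
theorem hexConnectiveConstant_mul_exp_onsetBound_le_surfaceMu (h : yStar < y) :
    hexConnectiveConstant * Real.exp (onsetBound y) ≤ surfaceMu y := by
  have hμpos : 0 < hexConnectiveConstant := hexConnectiveConstant_pos
  have hM : 0 < surfaceMu y := surfaceMu_pos y
  have h1 := onsetBound_le h
  have h2 : Real.log (hexConnectiveConstant * Real.exp (onsetBound y)) ≤ Real.log (surfaceMu y) := by
    rw [Real.log_mul hμpos.ne' (Real.exp_pos _).ne', Real.log_exp]; linarith
  exact (Real.log_le_log_iff (mul_pos hμpos (Real.exp_pos _)) hM).1 h2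

/-- `μ < μ(y)` for `y > y_c`, re-derived from the explicit excess (the tree's qualitative
`hexConnectiveConstant_lt_surfaceMu_iff` is not used). [cite: BeatonBousquetMelouDeGierDuminilCopinGuttmann2014, Proposition 5 (arXiv v5 p. 9) with Theorem 2 (§§4.2, 4.5, pp. 14–15)] -/
theorem hexConnectiveConstant_lt_surfaceMu_of_yStar_lt (h : yStar < y) : hexConnectiveConstant < surfaceMu y := by
  have hμpos : 0 < hexConnectiveConstant := hexConnectiveConstant_pos
  have h1 := hexConnectiveConstant_mul_exp_onsetBound_le_surfaceMu h
  have h2 : 1 < Real.exp (onsetBound y) := by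
    exact Real.one_lt_exp_iff.2 (onsetBound_pos h)
  calc hexConnectiveConstant = hexConnectiveConstant * 1 := (mul_one _).symm
    _ < hexConnectiveConstant * Real.exp (onsetBound y) := mul_lt_mul_of_pos_left h2 hμpos
    _ ≤ surfaceMu y := h1

/-! ## §5 The other side and the surface density: `log μ(y) − log μ ≤ (log y − log y_c)/2`, and
`onsetBound(y)/log(y/y_c) ≤ y μ'(y)/μ(y) ≤ 1/2`

`G(t) = log μ(eᵗ)` is convex on `ℝ` (tree `convexOn_log_surfaceMu_exp`, BBdGDCG14 Proposition 5: "a log-convex, non-decreasing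
function of log y") and `G(t) ≤ log μ + t/2` for `t ≥ 0` (tree `surfaceMu_le_sqrt_mul`: at most every other vertex of a
half-plane walk lies on the surface — the honeycomb analogue of the `d = 2` display of Janse van Rensburg's Theorem 5.55 for
positive polygons, `[log z]/2 ≤ 𝓕ᵥ⁺(z) ≤ log μ₂ + [log z]/2`; for walks the same page prints `log z ≤ 𝓕ᵥ⁺(z) ≤ log μ₂ + log z`).  A convex function lying below a line of slope `1/2` near `+∞` has ALL its secant
slopes `≤ 1/2` (`slope_log_surfaceMu_exp_le_half`).  Anchoring the secant at `G(log y_c) = log μ` gives the explicit UPPER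
modulus of the excess, `log μ(y) − log μ ≤ (log y − log y_c)/2`, i.e. `μ(y) ≤ μ·√(y/y_c)` (`y ≥ y_c`), complementing §4;
and at a point where `μ'(y)` exists the two tangent inequalities of a convex function turn §4 and the slope bound into
explicit bounds for the surface density `y μ'(y)/μ(y)` of BBdGDCG14's remark after Proposition 5 (arXiv v5 p. 10: "the density of
vertices on the surface is 0 for y < y_c and is positive for y > y_c"; tree `deriv_surfaceMu_pos`, qualitative):
`0 < onsetBound(y)/(log y − log y_c) ≤ y μ'(y)/μ(y) ≤ 1/2` for `y > y_c`.

Relation to the tree, disclosed BY NAME.  The UPPER-side statements of this section are the `μ(y)`-vocabulary forms of the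
wall-bridge-rate theorems of the lane's `HexSAWSurfaceWallRateSqrtMonotone` (a-p5 g12) under the identification
`wallRate_eq_surfaceMu` of `HexSAWSurfaceWallRateEq`: `log_surfaceMu_exp_le` ↔ `log_wallRate_exp_le`,
`slope_log_surfaceMu_exp_le_half` ↔ `log_wallRate_exp_sub_le`, `surfaceMu_le_mul_sqrt_div_yStar` ↔ `wallRate_le_sqrt_mul` at
`y = y_c` (ed.5: = tree `HexSAWSurfaceMuSqrtEnvelope`'s `surfaceMu_le_mul_sqrt_div`, imported and used), `log_surfaceMu_sub_log_le_half` ↔ the upper half of `log_wallRate_sub_log_wallRate_mem_Icc` at `y = y_c`, and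
`mul_deriv_div_le_half` ↔ `mul_deriv_wallRate_le_half`.  They are re-derived here in a few lines from
`HexSAWSurfaceYcProp5Riders` (`convexOn_log_surfaceMu_exp`, `surfaceMu_le_sqrt_mul`) in `μ(y)`-vocabulary (ed.5: `HexSAWSurfaceWallRateSqrtMonotone`
now enters transitively through the import `HexSAWSurfaceMuSqrtEnvelope`; `HexSAWSurfaceWallRateEq` is still not imported), and they are
CONSOLIDATION — nothing on the upper side is claimed new.  New here (lane composite) is the
explicit, strictly positive LOWER bound on the surface density, `onsetBound_div_le_mul_deriv_div` / `onsetBound_div_pos`, and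
the resulting explicit sandwich `surfaceDensity_explicit`. -/

/-- `log μ(eᵗ) ≤ log μ + t/2` for `t ≥ 0` (the tree's `μ(y) ≤ √y·μ`, `y ≥ 1`, in logarithmic form; the `μ(y)`-form of
tree `log_wallRate_exp_le` via `wallRate_eq_surfaceMu` — CONSOLIDATION).
[cite: BeatonBousquetMelouDeGierDuminilCopinGuttmann2014, §3.1, Proposition 5 (arXiv v5 p. 9) and the density remark after it (p. 10)] [cite: JansevanRensburg2000, Theorem 5.55 (d = 2 display, positive polygons)] -/
theorem log_surfaceMu_exp_le {t : ℝ} (ht : 0 ≤ t) :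
    Real.log (surfaceMu (Real.exp t)) ≤ Real.log hexConnectiveConstant + t / 2 := by
  have h1 : (1 : ℝ) ≤ Real.exp t := by rw [← Real.exp_zero]; exact Real.exp_le_exp.2 ht
  have h := surfaceMu_le_sqrt_mul h1
  have hs : Real.log (Real.sqrt (Real.exp t)) = t / 2 := by
    rw [Real.log_sqrt (Real.exp_pos t).le, Real.log_exp]
  calc Real.log (surfaceMu (Real.exp t)) ≤ Real.log (Real.sqrt (Real.exp t) * hexConnectiveConstant) :=
        Real.log_le_log (surfaceMu_pos _) h
    _ = Real.log hexConnectiveConstant + t / 2 := by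
        rw [Real.log_mul (Real.sqrt_pos.2 (Real.exp_pos t)).ne' hexConnectiveConstant_pos.ne', hs]; ring

/-- ★ **Every secant slope of `t ↦ log μ(eᵗ)` is at most `1/2`:** for `a < t`,
`(log μ(eᵗ) − log μ(eᵃ))/(t − a) ≤ 1/2`.  (Convexity: the secant slope from `a` is non-decreasing in the right endpoint `s`,
and for `s → +∞` it is at most `(log μ + s/2 − log μ(eᵃ))/(s − a) → 1/2`.)  The `μ(y)`-form of tree
`log_wallRate_exp_sub_le` (`HexSAWSurfaceWallRateSqrtMonotone`) via `wallRate_eq_surfaceMu` — CONSOLIDATION, re-derived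
here without that import.
[cite: BeatonBousquetMelouDeGierDuminilCopinGuttmann2014, §3.1, Proposition 5 (arXiv v5 p. 9, zig-zag remark same page)] [cite: HammersleyTorrieWhittington1982, §2] -/
theorem slope_log_surfaceMu_exp_le_half {a t : ℝ} (hat : a < t) :
    (Real.log (surfaceMu (Real.exp t)) - Real.log (surfaceMu (Real.exp a))) / (t - a) ≤ 1 / 2 := by
  set G : ℝ → ℝ := fun u => Real.log (surfaceMu (Real.exp u)) with hG
  have hconv : ConvexOn ℝ Set.univ G := convexOn_log_surfaceMu_exp
  have hmono : ∀ s, t ≤ s → (G t - G a) / (t - a) ≤ (G s - G a) / (s - a) := fun s hs =>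
    hconv.secant_mono (Set.mem_univ a) (Set.mem_univ t) (Set.mem_univ s) hat.ne' (hat.trans_le hs).ne' hs
  set K : ℝ := Real.log hexConnectiveConstant + a / 2 - G a with hK
  have hg : Tendsto (fun s : ℝ => s - a) atTop atTop := by
    simpa [sub_eq_add_neg] using tendsto_atTop_add_const_right atTop (-a) tendsto_id
  have h0 : Tendsto (fun s : ℝ => K / (s - a)) atTop (𝓝 0) := tendsto_const_nhds.div_atTop hg
  have hlim : Tendsto (fun s : ℝ => (Real.log hexConnectiveConstant + s / 2 - G a) / (s - a)) atTop (𝓝 (1 / 2)) := by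
    have h1 : Tendsto (fun s : ℝ => 1 / 2 + K / (s - a)) atTop (𝓝 (1 / 2 + 0)) := tendsto_const_nhds.add h0
    rw [add_zero] at h1
    refine h1.congr' ?_
    filter_upwards [eventually_gt_atTop a] with s hs
    have hsa : s - a ≠ 0 := sub_ne_zero.2 hs.ne'
    rw [hK]
    field_simp
    ring
  refine ge_of_tendsto hlim ?_
  filter_upwards [eventually_ge_atTop (max t 0)] with s hs
  have hts : t ≤ s := (le_max_left _ _).trans hs
  have hs0 : 0 ≤ s := (le_max_right _ _).trans hs
  have hsa : 0 < s - a := by linarith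
  calc (G t - G a) / (t - a) ≤ (G s - G a) / (s - a) := hmono s hts
    _ ≤ (Real.log hexConnectiveConstant + s / 2 - G a) / (s - a) :=
        div_le_div_of_nonneg_right (by linarith [log_surfaceMu_exp_le hs0]) hsa.le

/-- `μ(y_c) = μ` at `y_c = y* = 1 + √2`. [cite: BeatonBousquetMelouDeGierDuminilCopinGuttmann2014, Theorem 2 (arXiv v5 p. 3: "The critical surface fugacity for self-avoiding walks on the honeycomb lattice is y_c = 1+√2") with §3.1 Proposition 5 (p. 9)] -/
theorem surfaceMu_yStar : surfaceMu yStar = hexConnectiveConstant :=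
  (surfaceMu_eq_iff yStar_pos).2 (le_of_eq rfl)

/-- ★ **The explicit UPPER modulus of the adsorption excess: `log μ(y) − log μ ≤ (log y − log y_c)/2` for `y ≥ y_c = 1+√2`**
— with §4's `onsetBound_le` a two-sided explicit enclosure of the excess on the whole adsorbed phase.
(The `y = y_c` instance of the upper half of tree `log_wallRate_sub_log_wallRate_mem_Icc` via `wallRate_eq_surfaceMu` and
`μ(y_c) = μ` — CONSOLIDATION, re-derived here without that import.)
[cite: BeatonBousquetMelouDeGierDuminilCopinGuttmann2014, §3.1, Proposition 5 (arXiv v5 p. 9: "μ(y) ≥ max(μ, √y)", zig-zag remark same page); lane rider — the anchored form is not printed] [cite: JansevanRensburg2000, Theorem 5.55, Corollary 5.56] -/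
theorem log_surfaceMu_sub_log_le_half (h : yStar ≤ y) :
    Real.log (surfaceMu y) - Real.log hexConnectiveConstant ≤ (Real.log y - Real.log yStar) / 2 := by
  have hyc : 0 < yStar := yStar_pos
  have hy0 : 0 < y := hyc.trans_le h
  rcases eq_or_lt_of_le h with rfl | hlt
  · rw [surfaceMu_yStar]; simp
  · have ht : Real.log yStar < Real.log y := Real.log_lt_log hyc hlt
    have hs := slope_log_surfaceMu_exp_le_half ht
    rw [Real.exp_log hy0, Real.exp_log hyc, surfaceMu_yStar] at hs
    have hpos : 0 < Real.log y - Real.log yStar := sub_pos.2 ht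
    rw [div_le_iff₀ hpos] at hs
    linarith

/-- `μ(y) ≤ μ · √(y / y_c)` for `y ≥ y_c = yStar` (the upper modulus, exponentiated; sharper than the tree's `μ(y) ≤ μ√y` by the
factor `√y_c`).  Ed.5: this is the tree's `SAW.HV.surfaceMu_le_mul_sqrt_div` (`HexSAWSurfaceMuSqrtEnvelope`, hypothesis `1 + √2 ≤ y`,
bound `μ_ℍ · √(y / (1 + √2))`) read through `yStar = 1 + √2` (definitional) — USED, not re-derived; the `y = y_c` instance of tree
`wallRate_le_sqrt_mul` via `wallRate_eq_surfaceMu` — CONSOLIDATION. [cite: BeatonBousquetMelouDeGierDuminilCopinGuttmann2014, §3.1, Proposition 5 (arXiv v5 p. 9: "μ(y) ≥ max(μ, √y)", "μ(y) ∼ √y", zig-zag remark same page) with Theorem 2 (p. 3: y_c = 1+√2); lane: elementary] -/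
theorem surfaceMu_le_mul_sqrt_div_yStar (h : yStar ≤ y) :
    surfaceMu y ≤ hexConnectiveConstant * Real.sqrt (y / yStar) :=
  surfaceMu_le_mul_sqrt_div h

/-- ★★ **Two-sided explicit enclosure of the adsorption excess on the adsorbed phase:**
`onsetBound y ≤ log μ(y) − log μ ≤ (log y − log y_c)/2` for every `y > y_c = 1+√2`.
[cite: BeatonBousquetMelouDeGierDuminilCopinGuttmann2014, §3.1 Proposition 5, §3.2 Propositions 6–7, Corollary 8 (arXiv v5 pp. 9–12); lane composite] [cite: JansevanRensburg2000, Theorem 5.55, Corollary 5.56] -/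
theorem onsetBound_le_and_le_half (h : yStar < y) :
    onsetBound y ≤ Real.log (surfaceMu y) - Real.log hexConnectiveConstant ∧
      Real.log (surfaceMu y) - Real.log hexConnectiveConstant ≤ (Real.log y - Real.log yStar) / 2 :=
  ⟨onsetBound_le h, log_surfaceMu_sub_log_le_half h.le⟩

/-- ★ **Explicit lower bound on the surface density in the adsorbed phase:** for `y > y_c` at which `μ'(y)` exists,
`onsetBound y / (log y − log y_c) ≤ y μ'(y)/μ(y)` — the secant of the convex `log μ ∘ exp` from `log y_c` lies below the
tangent at `log y`, and §4 bounds the secant's rise from below.  Quantifies the tree's `deriv_surfaceMu_pos`.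
[cite: BeatonBousquetMelouDeGierDuminilCopinGuttmann2014, §3.1, density remark after Proposition 5 (arXiv v5 p. 10: "the density of vertices on the surface is 0 for y < y_c and is positive for y > y_c"); lane composite — the explicit bound is not printed] -/
theorem onsetBound_div_le_mul_deriv_div (h : yStar < y) (hd : DifferentiableAt ℝ surfaceMu y) :
    onsetBound y / (Real.log y - Real.log yStar) ≤ y * deriv surfaceMu y / surfaceMu y := by
  have hyc : 0 < yStar := yStar_pos
  have hy0 : 0 < y := hyc.trans h
  have ht : Real.log yStar < Real.log y := Real.log_lt_log hyc h
  have hd' : HasDerivAt surfaceMu (deriv surfaceMu y) (Real.exp (Real.log y)) := by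
    rw [Real.exp_log hy0]; exact hd.hasDerivAt
  have hG : HasDerivAt (fun t : ℝ => Real.log (surfaceMu (Real.exp t)))
      (deriv surfaceMu y * Real.exp (Real.log y) / surfaceMu (Real.exp (Real.log y))) (Real.log y) :=
    (hd'.comp (Real.log y) (Real.hasDerivAt_exp _)).log (surfaceMu_pos _).ne'
  have hslope := convexOn_log_surfaceMu_exp.slope_le_of_hasDerivAt (Set.mem_univ _) (Set.mem_univ _) ht hG
  simp only [slope_def_field] at hslope
  rw [Real.exp_log hy0, Real.exp_log hyc, surfaceMu_yStar] at hslope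
  have hpos : 0 < Real.log y - Real.log yStar := sub_pos.2 ht
  calc onsetBound y / (Real.log y - Real.log yStar)
      ≤ (Real.log (surfaceMu y) - Real.log hexConnectiveConstant) / (Real.log y - Real.log yStar) :=
        div_le_div_of_nonneg_right (onsetBound_le h) hpos.le
    _ ≤ deriv surfaceMu y * y / surfaceMu y := hslope
    _ = y * deriv surfaceMu y / surfaceMu y := by rw [mul_comm (deriv surfaceMu y)]

/-- The lower density bound is strictly positive: `0 < onsetBound y / (log y − log y_c)` for `y > y_c`.
[cite: BeatonBousquetMelouDeGierDuminilCopinGuttmann2014, §3.1, density remark after Proposition 5 (arXiv v5 p. 10)] -/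
theorem onsetBound_div_pos (h : yStar < y) : 0 < onsetBound y / (Real.log y - Real.log yStar) :=
  div_pos (onsetBound_pos h) (sub_pos.2 (Real.log_lt_log yStar_pos h))

/-- ★ **Explicit upper bound on the surface density, everywhere:** at any `y > 0` at which `μ'(y)` exists,
`y μ'(y)/μ(y) ≤ 1/2` — the tangent of the convex `log μ ∘ exp` at `log y` lies below the secant to `log y + 1`, whose slope
is at most `1/2`.  (The `μ(y)`-form of tree `mul_deriv_wallRate_le_half` via `wallRate_eq_surfaceMu` — CONSOLIDATION, re-derived here
without that import.) [cite: BeatonBousquetMelouDeGierDuminilCopinGuttmann2014, §3.1, Proposition 5 (arXiv v5 p. 9, zig-zag remark same page); lane rider] [cite: JansevanRensburg2000, Theorem 5.55 (d = 2, positive polygons: at most n/2 visits)] -/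
theorem mul_deriv_div_le_half (hy0 : 0 < y) (hd : DifferentiableAt ℝ surfaceMu y) :
    y * deriv surfaceMu y / surfaceMu y ≤ 1 / 2 := by
  have hd' : HasDerivAt surfaceMu (deriv surfaceMu y) (Real.exp (Real.log y)) := by
    rw [Real.exp_log hy0]; exact hd.hasDerivAt
  have hG : HasDerivAt (fun t : ℝ => Real.log (surfaceMu (Real.exp t)))
      (deriv surfaceMu y * Real.exp (Real.log y) / surfaceMu (Real.exp (Real.log y))) (Real.log y) :=
    (hd'.comp (Real.log y) (Real.hasDerivAt_exp _)).log (surfaceMu_pos _).ne'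
  have hlt : Real.log y < Real.log y + 1 := by linarith
  have hle := convexOn_log_surfaceMu_exp.le_slope_of_hasDerivAt (Set.mem_univ _) (Set.mem_univ _) hlt hG
  have hs := slope_log_surfaceMu_exp_le_half hlt
  simp only [slope_def_field] at hle
  rw [Real.exp_log hy0] at hle hs
  calc y * deriv surfaceMu y / surfaceMu y = deriv surfaceMu y * y / surfaceMu y := by rw [mul_comm y]
    _ ≤ (Real.log (surfaceMu (Real.exp (Real.log y + 1))) - Real.log (surfaceMu y)) / (Real.log y + 1 - Real.log y) := hle
    _ ≤ 1 / 2 := hs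

/-- ★★ **The surface density of the adsorbed phase, two-sidedly and explicitly:** for `y > y_c = 1+√2` at which `μ'(y)`
exists (a.e. `y`), `0 < onsetBound y/(log y − log y_c) ≤ y μ'(y)/μ(y) ≤ 1/2`.
[cite: BeatonBousquetMelouDeGierDuminilCopinGuttmann2014, §3.1, Proposition 5 (arXiv v5 p. 9) and the density remark after it (p. 10); lane composite — the explicit bounds are not printed] -/
theorem surfaceDensity_explicit (h : yStar < y) (hd : DifferentiableAt ℝ surfaceMu y) :
    0 < onsetBound y / (Real.log y - Real.log yStar) ∧
      onsetBound y / (Real.log y - Real.log yStar) ≤ y * deriv surfaceMu y / surfaceMu y ∧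
        y * deriv surfaceMu y / surfaceMu y ≤ 1 / 2 :=
  ⟨onsetBound_div_pos h, onsetBound_div_le_mul_deriv_div h hd, mul_deriv_div_le_half (yStar_pos.trans h) hd⟩

end HV

end Literature.Probability.RandomPlanarGeometry.SAW
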